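import Literature.MathematicalPhysics.QuantumFieldTheory.Balaban1983to89.Node00.Record12BgRowGaugeC1

/-!
# NODE 00 — ROW P11: the two scale-free letters of the C¹ route (`hletterI`, `hletterMS` of `bgRowAt_of_thm1ScaledSepC1`) FROM THE NUMERICS —
# «C₀ sufficiently large» once more: `Λ·cR·A₀ ≤ t·C₀`, `t < O(1)LMB` (resp. `t < B·C·M`)

Cell `pub-ymgap`, seat `pub-ymgap-node00-def-P11` g2 (R218 ∕ OPS-NOTE-16), sequel of `Record12BgRowGaugeC1` (p502553).  [III] = [Balaban1988Convergent].

HONEST FRAMING.  Elementary real inequalities (FILE 2 §1's `mul_eps_le_mul_alpha0` with a composite constant); nothing of Bałaban asserted or discharged; K0‴ NOT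
closed; counts unmoved (typed 28∕28 · discharged 5∕28); finite `𝕋⁴` programme; not continuum ∕ OS ∕ mass gap ∕ Clay.  No `def`, no `instance`, no `sorry`.

THE LETTERS.  With `b = B₃·cR·ε_j`, `b′ = B₃′·cR·ε_j` (`ε_j = g_j A₀ (log g_j⁻²)^{p₀}`, (2.4)), `X := cR·ε_j ≤ a₁`: `4(b + (d−1)Y·b′ + 4((d−1)Y)²b²) ≤ Λ(Y)·X` with
`Λ(Y) := 4(B₃ + (d−1)Y·B₃′) + 16((d−1)Y)²B₃²·a₁` (`X² ≤ a₁X`), and `Λ·cR·ε_j ≤ t·α₀(g_j)` as soon as `p₀ ≤ q₀` and `Λ·cR·A₀ ≤ t·C₀` (FILE 2 `mul_eps_le_mul_alpha0`);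
so `hletterI` (`Y = LM`, `t < O(1)LMB = cB`) and `hletterMS` (`Y = M`, `t < B·C·M`, `rad238 B C M α = B·C·M·α`) hold along the window.  ★ `bgRowAt_of_thm1ScaledSepC1_letters`:
FILE 7b's ★★★ with the two letters replaced by these numerics.

CONTENTS.  `letter_le_mul`, `letter_lt_of_numerics`, `hletterI_of_numerics`, `hletterMS_of_numerics`, ★ `bgRowAt_of_thm1ScaledSepC1_letters`.
-/

noncomputable section

open scoped Matrix.Norms.L2Operator

namespace Literature.MathematicalPhysics.QuantumFieldTheory.Balaban1983to89.Node00

open T4Continuum B14.Eq218Concrete B15DeterminingSets B12RegularSpaces111 B14RegularSpaces234 B14Radii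

/-! ## §1  The composite letter -/

section Letters

/-- The algebra of the letter: for `0 ≤ X ≤ a₁`, `4(B₃X + D·Y·B₃′X + 4(D·Y)²(B₃X)²) ≤ (4(B₃ + D·Y·B₃′) + 16(D·Y)²B₃²a₁)·X`.
[cite: Balaban1988Convergent, (2.28) p.259 (elementary)] -/
theorem letter_le_mul {B₃ B₃' D Y X a₁ : ℝ} (hX : 0 ≤ X) (hXa : X ≤ a₁) :
    4 * (B₃ * X + D * Y * (B₃' * X) + 4 * (D * Y) ^ 2 * (B₃ * X) ^ 2) ≤ (4 * (B₃ + D * Y * B₃') + 16 * (D * Y) ^ 2 * B₃ ^ 2 * a₁) * X := by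
  have hX2 : X ^ 2 ≤ a₁ * X := by rw [sq]; exact mul_le_mul_of_nonneg_right hXa hX
  have h0 : 0 ≤ 16 * (D * Y) ^ 2 * B₃ ^ 2 := by positivity
  nlinarith [mul_le_mul_of_nonneg_left hX2 h0]

/-- **THE LETTER ALONG THE WINDOW** («C₀ sufficiently large»): with `X = cR·ε_j`, `0 ≤ X ≤ a₁`, `0 < g_j`, `g_j² ≤ e⁻¹`, `p₀ ≤ q₀`, `0 ≤ Λ·cR·A₀ ≤ t·C₀` for
`Λ = 4(B₃ + D·Y·B₃′) + 16(D·Y)²B₃²a₁`, and `t < R`, `0 < α₀(g_j)`: `4(b + D·Y·b′ + 4(D·Y)²b²) < R·α₀(g_j)` (no sign hypotheses on `B₃, B₃′, D, Y` are needed). [cite: Balaban1988Convergent, (2.4) p.255, (2.28) p.259] -/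
theorem letter_lt_of_numerics (lf : Step.LFConsts) (ν : Stage7Numerics) {B₃ B₃' D Y cR a₁ t R : ℝ} {g : ℕ → ℝ} {j : ℕ}
    (hg : 0 < g j) (hge : g j ^ 2 ≤ Real.exp (-1)) (hpq : ν.p₀ ≤ lf.q₀)
    (hX : 0 ≤ cR * epsOfRecord ν g j) (hXa : cR * epsOfRecord ν g j ≤ a₁)
    (hΛ0 : 0 ≤ (4 * (B₃ + D * Y * B₃') + 16 * (D * Y) ^ 2 * B₃ ^ 2 * a₁) * cR * ν.A₀)
    (hΛ : (4 * (B₃ + D * Y * B₃') + 16 * (D * Y) ^ 2 * B₃ ^ 2 * a₁) * cR * ν.A₀ ≤ t * lf.C₀) (htR : t < R) (hα : 0 < lf.alpha0 (g j)) :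
    4 * (B₃ * (cR * epsOfRecord ν g j) + D * Y * (B₃' * (cR * epsOfRecord ν g j)) + 4 * (D * Y) ^ 2 * (B₃ * (cR * epsOfRecord ν g j)) ^ 2) <
      R * lf.alpha0 (g j) := by
  have h1 := letter_le_mul (B₃ := B₃) (B₃' := B₃') (D := D) (Y := Y) hX hXa
  have h2 : (4 * (B₃ + D * Y * B₃') + 16 * (D * Y) ^ 2 * B₃ ^ 2 * a₁) * (cR * epsOfRecord ν g j) ≤ t * lf.alpha0 (g j) := by
    unfold epsOfRecord
    exact mul_eps_le_mul_alpha0 lf hg.le (one_le_log_inv_sq hg hge) hpq hΛ0 hΛ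
  have h3 : t * lf.alpha0 (g j) < R * lf.alpha0 (g j) := mul_lt_mul_of_pos_right htR hα
  linarith

/-- **`hletterI` OF `bgRowAt_of_thm1ScaledSepC1` FROM THE NUMERICS** (`Y = L·M`, `R = O(1)LMB = cB`). [cite: Balaban1988Convergent, (2.28) p.259; Balaban1987RG1, (1.12) p.262] -/
theorem hletterI_of_numerics {P : Params} (lf : Step.LFConsts) (ν : Stage7Numerics) {B₃ B₃' cR a₁ t cB : ℝ} (M : ℕ) {g : ℕ → ℝ} {k : ℕ}
    (hg : ∀ j, 1 ≤ j → j ≤ k → 0 < g j ∧ g j ^ 2 ≤ Real.exp (-1)) (hpq : ν.p₀ ≤ lf.q₀)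
    (hnum : ∀ j, j ≤ k → 0 < cR * epsOfRecord ν g j ∧ cR * epsOfRecord ν g j ≤ a₁)
    (hΛ0 : 0 ≤ (4 * (B₃ + ((P.d - 1 : ℕ) : ℝ) * ((P.L : ℝ) * M) * B₃') + 16 * (((P.d - 1 : ℕ) : ℝ) * ((P.L : ℝ) * M)) ^ 2 * B₃ ^ 2 * a₁) * cR * ν.A₀)
    (hΛ : (4 * (B₃ + ((P.d - 1 : ℕ) : ℝ) * ((P.L : ℝ) * M) * B₃') + 16 * (((P.d - 1 : ℕ) : ℝ) * ((P.L : ℝ) * M)) ^ 2 * B₃ ^ 2 * a₁) * cR * ν.A₀ ≤ t * lf.C₀)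
    (ht : t < cB) (hα : ∀ j, 1 ≤ j → j ≤ k → 0 < lf.alpha0 (g j)) :
    ∀ j, 1 ≤ j → j ≤ k →
      4 * (B₃ * (cR * epsOfRecord ν g j) + ((P.d - 1 : ℕ) : ℝ) * ((P.L : ℝ) * M) * (B₃' * (cR * epsOfRecord ν g j)) +
        4 * (((P.d - 1 : ℕ) : ℝ) * ((P.L : ℝ) * M)) ^ 2 * (B₃ * (cR * epsOfRecord ν g j)) ^ 2) < cB * lf.alpha0 (g j) :=
  fun j h1 hjk => letter_lt_of_numerics lf ν (hg j h1 hjk).1 (hg j h1 hjk).2 hpq (hnum j hjk).1.le (hnum j hjk).2 hΛ0 hΛ ht (hα j h1 hjk)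

/-- **`hletterMS` OF `bgRowAt_of_thm1ScaledSepC1` FROM THE NUMERICS** (`Y = M`, `R = B·C·M_r`, `rad238 B C M_r α = B·C·M_r·α`). [cite: Balaban1988Convergent, (2.38) p.261, (2.28) p.259] -/
theorem hletterMS_of_numerics {P : Params} (lf : Step.LFConsts) (ν : Stage7Numerics) {B₃ B₃' cR a₁ t B C Mr : ℝ} (M : ℕ) {g : ℕ → ℝ} {k : ℕ}
    (hg : ∀ n, 1 ≤ n → n ≤ k → 0 < g n ∧ g n ^ 2 ≤ Real.exp (-1)) (hpq : ν.p₀ ≤ lf.q₀)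
    (hnum : ∀ n, n ≤ k → 0 < cR * epsOfRecord ν g n ∧ cR * epsOfRecord ν g n ≤ a₁)
    (hΛ0 : 0 ≤ (4 * (B₃ + ((P.d - 1 : ℕ) : ℝ) * (M : ℝ) * B₃') + 16 * (((P.d - 1 : ℕ) : ℝ) * (M : ℝ)) ^ 2 * B₃ ^ 2 * a₁) * cR * ν.A₀)
    (hΛ : (4 * (B₃ + ((P.d - 1 : ℕ) : ℝ) * (M : ℝ) * B₃') + 16 * (((P.d - 1 : ℕ) : ℝ) * (M : ℝ)) ^ 2 * B₃ ^ 2 * a₁) * cR * ν.A₀ ≤ t * lf.C₀)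
    (ht : t < B * C * Mr) (hα : ∀ n, 1 ≤ n → n ≤ k → 0 < lf.alpha0 (g n)) :
    ∀ n, 1 ≤ n → n ≤ k →
      4 * (B₃ * (cR * epsOfRecord ν g n) + ((P.d - 1 : ℕ) : ℝ) * (M : ℝ) * (B₃' * (cR * epsOfRecord ν g n)) +
        4 * (((P.d - 1 : ℕ) : ℝ) * (M : ℝ)) ^ 2 * (B₃ * (cR * epsOfRecord ν g n)) ^ 2) < rad238 B C Mr (lf.alpha0 (g n)) := by
  intro n h1 hnk
  unfold rad238
  exact letter_lt_of_numerics lf ν (hg n h1 hnk).1 (hg n h1 hnk).2 hpq (hnum n hnk).1.le (hnum n hnk).2 hΛ0 hΛ ht (hα n h1 hnk)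

end Letters

/-! ## §2  ★ The faithful chain of the C¹ route with the letters discharged from the numerics -/

section Record

variable {F : T4Family} {N : ℕ} [NeZero N]

/-- **★ `bgRowAt_of_thm1ScaledSepC1` WITH THE TWO LETTERS FROM THE NUMERICS**: the row's body at a separated sequence with comparable thresholds from
`VariationalThm1ScaledSep` ((8)), the displayed C¹ class datum `hclassC1` ((9)–(10), gauge-free reading), the window (`0 < g_j`, `g_j² ≤ e⁻¹`), the numerics
(`p₀ ≤ q₀`; `0 < cR·ε_j ≤ a₁`, `B₃cRε_j ≤ εreg ≤ a₀`; `B₃cRε_j ≤ (1−β)α₀`; the two «C₀ sufficiently large» letters `Λ(LM)·cR·A₀ ≤ t_I·C₀`, `t_I < cB` and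
`Λ(M)·cR·A₀ ≤ t_MS·C₀`, `t_MS < B·C·M_r`; chart reachability), (C1)(C2), no wrapping, `hcomp`. [cite: Balaban1985Variational, Thm 1 (8)–(10) p.279; Balaban1988Convergent, (2.4)–(2.8) pp.255–256, (2.27)–(2.28) p.259, (2.34)–(2.41) p.261; Balaban1987RG1, (1.11)–(1.16) p.262] -/
theorem bgRowAt_of_thm1ScaledSepC1_letters {B₃ B₃' a₀ a₁ tI tMS : ℝ} (h15 : VariationalThm1ScaledSep F N B₃ a₀ a₁)
    (S : Sect2.Setting (MatA N) (SU N)) (hι : S.ι = ιSU N) (h𝓜 : S.𝓜 = B12RegularSpaces111SpecialUnitary.suModel N) (hS : S.Laws) (hpos : S.Pos)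
    (ν : Stage7Numerics) {M : ℕ} (hM : 0 < M) (K k : ℕ) (cR : ℝ) (hB₃ : 0 ≤ B₃) (hB₃' : 0 ≤ B₃')
    (hg : ∀ j, 1 ≤ j → j ≤ k → 0 < S.flow.g j ∧ S.flow.g j ^ 2 ≤ Real.exp (-1)) (hpq : ν.p₀ ≤ S.lf.q₀)
    (hnum : ∀ n, n ≤ k → 0 < cR * epsOfRecord ν S.flow.g n ∧ cR * epsOfRecord ν S.flow.g n ≤ a₁ ∧ B₃ * (cR * epsOfRecord ν S.flow.g n) ≤ ν.εreg)
    (ha₀ : ν.εreg ≤ a₀) (hcomp : ∀ n, n < k → cR * epsOfRecord ν S.flow.g n ≤ 2 * (cR * epsOfRecord ν S.flow.g (n + 1)))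
    (hα : ∀ n, 1 ≤ n → n ≤ k → 0 < S.lf.alpha0 (S.flow.g n) ∧ 0 < S.lf.alpha1 (S.flow.g n))
    (hBα : ∀ n, 1 ≤ n → n ≤ k → B₃ * (cR * epsOfRecord ν S.flow.g n) ≤ (1 - S.βc) * S.lf.alpha0 (S.flow.g n))
    (hΛI0 : 0 ≤ (4 * (B₃ + (((F.P K).d - 1 : ℕ) : ℝ) * (((F.P K).L : ℝ) * M) * B₃') + 16 * ((((F.P K).d - 1 : ℕ) : ℝ) * (((F.P K).L : ℝ) * M)) ^ 2 * B₃ ^ 2 * a₁) * cR * ν.A₀)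
    (hΛI : (4 * (B₃ + (((F.P K).d - 1 : ℕ) : ℝ) * (((F.P K).L : ℝ) * M) * B₃') + 16 * ((((F.P K).d - 1 : ℕ) : ℝ) * (((F.P K).L : ℝ) * M)) ^ 2 * B₃ ^ 2 * a₁) * cR * ν.A₀ ≤
      tI * S.lf.C₀) (htI : tI < S.cB)
    (hΛMS0 : 0 ≤ (4 * (B₃ + (((F.P K).d - 1 : ℕ) : ℝ) * (M : ℝ) * B₃') + 16 * ((((F.P K).d - 1 : ℕ) : ℝ) * (M : ℝ)) ^ 2 * B₃ ^ 2 * a₁) * cR * ν.A₀)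
    (hΛMS : (4 * (B₃ + (((F.P K).d - 1 : ℕ) : ℝ) * (M : ℝ) * B₃') + 16 * ((((F.P K).d - 1 : ℕ) : ℝ) * (M : ℝ)) ^ 2 * B₃ ^ 2 * a₁) * cR * ν.A₀ ≤ tMS * S.lf.C₀)
    (htMS : tMS < S.B * S.C * S.Mr)
    (hsN : ∀ n, 1 ≤ n → n ≤ k + 1 → ((B14.Eq213MaximalDomains.side (F.P K).L M n : ℕ) : ℤ) < (F.P K).sitesPerDir 0)
    (hcB : 2 * (((F.P K).d - 1 : ℕ) : ℝ) * ((F.P K).L * M) < S.cB) (hBCM : 2 * (((F.P K).d - 1 : ℕ) : ℝ) * M < S.B * S.C * S.Mr)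
    (hsmallI : ∀ j, 1 ≤ j → j ≤ k → (((F.P K).d - 1 : ℕ) : ℝ) * ((F.P K).L * M) * (F.P K).eta j * (B₃ * (cR * epsOfRecord ν S.flow.g j)) ≤ 1 / 2)
    (hsmallMS : ∀ n, 1 ≤ n → n ≤ k → (((F.P K).d - 1 : ℕ) : ℝ) * M * (F.P K).eta n * (B₃ * (cR * epsOfRecord ν S.flow.g n)) ≤ 1 / 2)
    (hC1 : ∀ j, 1 ≤ j → j ≤ k → ∃ t : ℕ, 0 < t ∧ RkOfRecord (F.P K).L ν.r (S.flow.g j) = (F.P K).L * t)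
    (hC2 : ∀ j, 1 ≤ j → j ≤ k → dCubeSide (F.P K).L M (RkOfRecord (F.P K).L ν.r (S.flow.g j)) j ∣ (F.P K).sitesPerDir 0)
    (s : SeqOfRecord F ν M S.flow.g K k) (hsep : Sect2.SeqSeparated ν.M₁ s)
    (hclassC1 : ∀ W : MSField (F.P K) (SU N), W ∈ regSuppOfRecord F N ν M S.flow.g K k cR s →
      W ∈ solvableDom (avOfRecord F N K) (regMSOfRecord F N ν K k s.Ω) (genSet s.Ω k) →
      ∀ n, 1 ≤ n → n ≤ k →
        PlaqC1SmallOn (plaqInside (s.Ω n)) (B₃' * (cR * epsOfRecord ν S.flow.g n) * (F.P K).eta n ^ 3) (UbgMSOfRecord F N ν M S.flow.g K k s W)) :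
    ∀ W : MSField (F.P K) (SU N), W ∈ regSuppOfRecord F N ν M S.flow.g K k cR s → ∀ j, 1 ≤ j → j ≤ k → ∀ X : (Sect2.domSys (F.P K) M j).Dom,
      (Sect2.domSites (F.P K) M j X ⊆ s.Λ j →
        Sect2.ofBackgroundC S.ι (UbgMSOfRecord F N ν M S.flow.g K k s W) ∈
          Sect2.spaceI S (Sect2.Residual.unit (F.P K) (MatA N)) M j (Sect2.domSites (F.P K) M j X) (S.lf.alpha0 (S.flow.g j)) (S.lf.alpha1 (S.flow.g j))) ∧
      (Sect2.admB (F.P K) ν M S.flow.g s.Ω s.Λ j (Sect2.domSites (F.P K) M j X) = true →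
        Sect2.ofBackgroundC S.ι (UbgMSOfRecord F N ν M S.flow.g K k s W) ∈
          Sect2.spaceMS S (Sect2.Residual.unit (F.P K) (MatA N)) M j (Sect2.domSites (F.P K) M j X) s.Ω) :=
  bgRowAt_of_thm1ScaledSepC1 h15 S hι h𝓜 hS hpos ν hM K k cR hB₃ hB₃' hnum ha₀ hcomp hα hBα hsN hcB hBCM hsmallI hsmallMS hC1 hC2 s hsep hclassC1
    (hletterI_of_numerics S.lf ν M hg hpq (fun j hj => ⟨(hnum j hj).1, (hnum j hj).2.1⟩) hΛI0 hΛI htI (fun j h1 hj => (hα j h1 hj).1))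
    (hletterMS_of_numerics S.lf ν M hg hpq (fun n hn => ⟨(hnum n hn).1, (hnum n hn).2.1⟩) hΛMS0 hΛMS htMS (fun n h1 hn => (hα n h1 hn).1))

end Record

end Literature.MathematicalPhysics.QuantumFieldTheory.Balaban1983to89.Node00

end
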